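import Mathlib
import Summits.ValiantsHypothesis.ValiantsHypothesis.Theorems.GeneratorObstructionsPowGenDegreeQPEvaluationLateness

/-!
# Route GeneratorObstructions — crux K1 `PerGenDegreeSuperQP` (stmt-ValiantsHypothesis-11654), line
# `per-side-atoms`: EVALUATION LATENESS as a by-name engine for K1

Helper file (`--supports stmt-ValiantsHypothesis-11654`).  The evaluation-lateness mechanism of
`…PowGenDegreeQPEvaluationLateness` (general form `f`; a nonconstant semi-invariant not vanishing at a
point whose upper-triangular stabiliser kills all small nonconstant weights forces a late GENERATOR
TYPE) is oriented here towards K1: by the generator principle (`γ_χ(g) ≤ γ_χ(per_m)` for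
`g ∈ Δ(per_m)`, landed `finrank_ne_zero_of_mem_orbitClosure`) it suffices to find such a point
ANYWHERE in the orbit closure of the permanent.

* `perGenDegreeSuperQP_of_evalLate` — **K1 by name** from: for every `c, m₀` a degree `m ≥ m₀` and a
  point `g ∈ Δ_{m²}(per_m)` (own lexicographic letters) carrying the lateness package — a set `S` of
  upper-triangular elements fixing `g`, a threshold `D > m · 2^((log₂ m + c)^c)` below which no
  nonconstant nonpositive weight is annihilated by `S`, and one highest-weight vector of nonconstant
  weight of `ℂ[Δ_m g]` not vanishing at `g`.

Remarks for the line.  (1) `per_m` itself is useless as the evaluation point: the only dominant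
weights annihilated by its row/column torus are CONSTANT, so every nonconstant semi-invariant vanishes
AT `per_m`.  (2) The doubling gadgets of `…PowGenDegreeQPDoublingGadget*` (sparse sums of monomials on
interleaved letters, admissible weights forced to double) show what a late-evaluable point looks
like; a point of `Δ(per_m)` with such a support (an `End`-image / labelled collapse of `per_m`) plus
the Kempf–Hilbert–Mumford nonvanishing would give K1 — the SAME input that refutes K2 for the trace
side.  Honest framing: a conditional format; no stub (`stub_atomLate`), crux or summit is settled;
`VP ≠ VNP` untouched.
-/

namespace Summit.ValiantsHypothesis.ValiantsHypothesis.Theorems.GeneratorObstructions.PerGenDegreeSuperQP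

open MvPolynomial
open Literature.NumberTheory.DiophantineGeometry Literature.Computability.AlgebraicComplexity
open Summit.ValiantsHypothesis.ValiantsHypothesis.Theses.GeneratorObstructions
open Summit.ValiantsHypothesis.ValiantsHypothesis.Theorems.GeneratorObstructions.SliceTransfer
open Summit.ValiantsHypothesis.ValiantsHypothesis.Theorems.GeneratorObstructions.PowGenDegreeQP

-- `Summit.ValiantsHypothesis.ValiantsHypothesis.…` is the tree's mandated single-conjunct layout.
set_option linter.dupNamespace false

noncomputable section

/-- **K1 from an evaluation-late point of `Δ(per_m)`.**  If for every `c, m₀` there are `m ≥ m₀`,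
`m ≥ 1`, a point `g` of the orbit closure of `per_m` (own `m²` lexicographic letters), a set `S` of
upper-triangular elements fixing `g` and `D > m · 2^((log₂ m + c)^c)` such that every nonconstant
nonpositive weight annihilated by `S` has `-|χ| ≥ D`, while some highest-weight vector of nonconstant
weight of `ℂ[Δ_m g]` does not vanish at `g`, then `PerGenDegreeSuperQP` (K1) holds:
`exists_late_genType_of_stabilizer` gives a generator type of `A(Δ g)` with `-|χ| ≥ D`, which is a
generator type of `A(Δ per_m)` by the generator principle. [cite: BurgisserEtAl2011, §5.2] -/
theorem perGenDegreeSuperQP_of_evalLate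
    (h : ∀ c m₀ : ℕ, ∃ m : ℕ, m₀ ≤ m ∧ 1 ≤ m ∧
      ∃ g ∈ orbitClosure (rename toLex (perPoly (Fin m) ℂ) : MvPolynomial (MatIdx m) ℂ),
        ∃ (S : Set (GL (MatIdx m) ℂ)) (D : ℤ),
          (∀ t ∈ S, IsUpperTriangular t ∧ linSubstRep (MatIdx m) ℂ t g = g) ∧
          (m : ℤ) * 2 ^ ((Nat.log 2 m + c) ^ c) < D ∧
          (∀ χ : Weight (MatIdx m), (∃ i j, χ i ≠ χ j) → (∀ i, χ i ≤ 0) →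
            (∀ t ∈ S, weightChar χ t = 1) → D ≤ -(Weight.size χ)) ∧
          (∃ χ₀ : Weight (MatIdx m), (∃ i j, χ₀ i ≠ χ₀ j) ∧
            ∃ x ∈ highestWeightSpace (orbitCoordRep g m) χ₀, evalAtPoint g m x ≠ 0)) :
    PerGenDegreeSuperQP := by
  intro c m₀
  obtain ⟨m, hm₀, hm1, g, hg, S, D, hS, hD, harith, h2⟩ := h c m₀
  obtain ⟨χ, -, hDle, hγ⟩ :=
    exists_late_genType_of_stabilizer g (m := m) (by omega) S hS D harith h2
  exact ⟨m, hm₀, χ, finrank_ne_zero_of_mem_orbitClosure (by omega) hg χ hγ, lt_of_lt_of_le hD hDle⟩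

/-- **The first nonvanishing degree at an evaluation-late point of `Δ(per_m)` is a generator degree
of `per_m`.**  Same hypotheses for ONE `m`: the conclusion names the late generator type of
`A(Δ per_m)` (`-|χ| ≥ D`).  [cite: BurgisserEtAl2011, §5.2] -/
theorem per_exists_late_genType_of_evalLate {m : ℕ} (hm : 1 ≤ m)
    {g : MvPolynomial (MatIdx m) ℂ} (hg : g ∈ orbitClosure (rename toLex (perPoly (Fin m) ℂ)))
    (S : Set (GL (MatIdx m) ℂ)) (hS : ∀ t ∈ S, IsUpperTriangular t ∧ linSubstRep (MatIdx m) ℂ t g = g)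
    (D : ℤ)
    (harith : ∀ χ : Weight (MatIdx m), (∃ i j, χ i ≠ χ j) → (∀ i, χ i ≤ 0) →
      (∀ t ∈ S, weightChar χ t = 1) → D ≤ -(Weight.size χ))
    (h2 : ∃ χ₀ : Weight (MatIdx m), (∃ i j, χ₀ i ≠ χ₀ j) ∧
      ∃ x ∈ highestWeightSpace (orbitCoordRep g m) χ₀, evalAtPoint g m x ≠ 0) :
    ∃ χ : Weight (MatIdx m), (∃ i j, χ i ≠ χ j) ∧ D ≤ -(Weight.size χ) ∧
      Module.finrank ℂ (↥(highestWeightSpace (orbitCoordRep (rename toLex (perPoly (Fin m) ℂ)) m) χ) ⧸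
        Submodule.comap (highestWeightSpace (orbitCoordRep (rename toLex (perPoly (Fin m) ℂ)) m) χ).subtype
          (⨆ p : Weight (MatIdx m) × Weight (MatIdx m), ⨆ (_ : p.1 + p.2 = χ ∧ p.1 ≠ 0 ∧ p.2 ≠ 0),
            highestWeightSpace (orbitCoordRep (rename toLex (perPoly (Fin m) ℂ)) m) p.1 *
              highestWeightSpace (orbitCoordRep (rename toLex (perPoly (Fin m) ℂ)) m) p.2)) ≠ 0 := by
  obtain ⟨χ, hnc, hDle, hγ⟩ :=
    exists_late_genType_of_stabilizer g (m := m) (by omega) S hS D harith h2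
  exact ⟨χ, hnc, hDle, finrank_ne_zero_of_mem_orbitClosure (by omega) hg χ hγ⟩

end

end Summit.ValiantsHypothesis.ValiantsHypothesis.Theorems.GeneratorObstructions.PerGenDegreeSuperQP
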